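import Summits.QuantumFields.BalabanUV.Beta.D1BFx.ChartDefectWords
import Summits.QuantumFields.BalabanUV.Beta.SymCorrectorTransport
import Summits.QuantumFields.BalabanUV.Beta.CombChartJointEnd
import Summits.QuantumFields.BalabanUV.Beta.CombOneShotJetsTabs
import Summits.QuantumFields.BalabanUV.Beta.AxialDressingRootedBmHessian

/-!
# `BalabanUV.Beta.D1BFx.ChartDefectWordsLiteral` — road «BF-x», row D1, the (J1) program: **W-3 AT THE LITERAL — PART 23-hyb's `RJ1 (Lc^m)` IS THREE
# ONE-LOOP WORDS AT `G₀^{bm}(ctrOff)`, WORD BY WORD** (companion of `D1BFx/ChartDefectWords` — split for the 400-line rule; `J1-DEFECT-WORDS.md` v0.1 §4,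
# OWNER-MEMO-g22 v3 §3″.1; an2 RULING R-D1-g43-3 (2)).

THE MATHEMATICS.  (d = 3, `n` odd.)  The chart-(III′) literal of record at one blocking reads `TOf (JsB12CombShSym … 0) = hessKer G′ (vertexOfK G′ n S⁰) W⁰`,
`G′ := GcombSh n 0`, `(S⁰, W⁰) := JsB12CombSh0 … 0` (α-form: `CombChartJointEnd.TbalOf_JsB12CombShSym` at `j = 0`); leaf-03's CHART TRANSPORT
`SymCorrectorTransport.GcombSh_zero_eq_conj_psiKS_KInvStep` gives `G′ = Ψ̂ ∘ G₀ ∘ Ψ̂ᵀ` with the road's kernel `G₀ := coDressKBmAt (toSite (ctrOff 4 n)) n (KInvStep n 0)`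
and `Ψ̂ := psiKS (ctrOff 4 n) n`; the generic file's (T1)(T2) then give:
* `TOf_JsB12CombShSym_eq_hessKer_bm_transported` — the literal IS the road's functional at `G₀` on the slot-transported, leg-dressed jets;
* **`chartDefect_literal_eq_words`** — `TOf (JsB12CombShSym … 0) μ ν z − hessKer G₀ (vertexOfK G₀ n S⁰) W μ ν z = ½·tadpole G₀ (Wᵈ μ 0 ν z)
  − ½·(bubble G₀ (V μ 0) (Vᵈ ν z) + bubble G₀ (Vᵈ μ 0) (V ν z)) − ½·bubble G₀ (Vᵈ μ 0) (Vᵈ ν z)` for EVERY localised reference `W` (`V := vertexOfK G₀ n S⁰`,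
  `Vᵈ := Ψ̂ᵀ∘vertexOfK G₀ n (slotPsiS ρ n S⁰)∘Ψ̂ − V`, `Wᵈ := Ψ̂ᵀ∘W⁰∘Ψ̂ − W`), and `chartDefect_literal_eq_words_pair` at `W := vertex2OfK G₀ n S₂`;
* **`RJ1_JcOfTabs_eq_words`** — ON THE SCALES `n := Lc^m` at `Jc := JcOfTabs hLc N tabs′ cΛ cB` (`JcOfTabs_apply`): PART 23-hyb's displayed defect
  `RJ1 (Lc^m) μ ν z = TshotOf Lc Jc m μ ν z − hessKer G₀ (vertexOfK G₀ (Lc^m) S⁰) (vertex2OfK G₀ (Lc^m) S₂) μ ν z` IS these three words — so (J1)'s ONE ROW `hC₁`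
  is the `m`-uniform (1.22) bound of three explicit one-loop words of the road's OWN functional on transported jets.  The literal's W slot is kept WHOLE.

HONEST DEPENDENCY (cell records, verbatim): «continuum YM on T⁴ ⇐ BetaPertH ∧ nine spine estimates (0/9 proved); BetaPertH ⇐ (D1) ∧ (D4) ∧
CAP+tail; G-an2-4 gates asym, D1 and NE2/3/4.»  HONEST FRAMING (cell contract, verbatim): «discharging `BetaPertH` makes Bałaban's UV stability
UNCONDITIONAL — a real constructive-QFT result; it is NOT the continuum limit and NOT the Clay problem.»  THIS MODULE DISCHARGES NOTHING of (K), of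
(J1)'s row, of D1 or of the wall: [folklore] exact identities between OUR kernels BY NAME; prices NO row, asserts no currency, proves NO clause of B12 Thm 2 ∕
Erice and NO estimate of Bałaban's.  No definition, no `def … : Prop`, nothing cited, 0 sorry.  0∕4 row-D1 binders; (K) NOT closed; (J1) = ONE OPEN ROW;
NOT D1, NEVER «G-an2-4 closed», NOT `BetaPertH`, NOT continuum, NOT Clay.

ABSOLUTE RULE (cell charter, verbatim): «No internally-minted statement may enter as a cited fact. Every hypothesis is either kernel-proved in this
package or a verbatim quotation of a PUBLISHED theorem with page reference. The manuscript(s) under audit are NOT citable for their own disputed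
steps — they are the thing under adjudication; programme-internal (2001/route/tribunal) claims are never citable.»

Unit `b2b-balaban-beta-d1-p2` (road owner, gen 23), 2026-08-23; no existing file touched.
-/

noncomputable section

namespace Summit.QuantumFields.BalabanUV.Beta.D1BFx.ChartDefectWordsLiteral

open Literature.MathematicalPhysics.QuantumFieldTheory
open Literature.MathematicalPhysics.QuantumFieldTheory.Balaban1983to89
open Literature.MathematicalPhysics.QuantumFieldTheory.Balaban1983to89.Beta
open B12Sec2to5 (l1 l1_nonneg)
open ExpKernelCalculus (MKer Decays BiLoc comp tadpole bubble hessKer)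
open OneStepResolventKernel (Fib JetData KInv TOf vertexOf LocStencil)
open OneStepKernelFamily (KInvStep vertexOfK TbalOf TstepOf TshotOf vertexOfK_KInv)
open SecondOrderResponse (vertex2OfK)
open BalabanCompositeJets (LocStencil₂)
open AffineAveraging (Site box toSite)
open AveragingContours (blk)
open AveragingContoursRooted (ctr ctrOff ctrOff_mem_box)
open Summit.QuantumFields.BalabanUV.Beta.TameKernelCalculus
open Summit.QuantumFields.BalabanUV.Beta.AxialDressingRooted (coDressKBmAt decays_coDressKBmAt_KInvStep one_le_of_neZero)
open Summit.QuantumFields.BalabanUV.Beta.BorderedHessian (KInvStep_zero_eq)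
open Summit.QuantumFields.BalabanUV.Beta.SymmetrisedStepJets (SymTables)
open Summit.QuantumFields.BalabanUV.Beta.CombChartStepJets (GcombSh JsB12CombSh0)
open Summit.QuantumFields.BalabanUV.Beta.CombChartJointEnd (JsB12CombShSym TbalOf_JsB12CombShSym)
open Summit.QuantumFields.BalabanUV.Beta.CombOneShotJetsTabs (JcOfTabs JcOfTabs_apply)
open Summit.QuantumFields.BalabanUV.Beta.SymCorrectorKernel (psiKS spr_psiKS)
open Summit.QuantumFields.BalabanUV.Beta.SymCorrectorFace (faceWt faceSum slotPsiS)
open Summit.QuantumFields.BalabanUV.Beta.SymCorrectorTransport (GcombSh_zero_eq_conj_psiKS_KInvStep)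
open Summit.QuantumFields.BalabanUV.Beta.D1BFx.ChartDefectWords

/-! ## §4 (T4) THE LITERAL: the (III′) one-shot kernel at one blocking, and PART 23-hyb's `RJ1` on the scales, word by word -/

section Literal

variable (n : ℕ) [NeZero n] (hodd : Odd n) (N : ℕ) (tabs : SymTables 3 n) (cΛ cB : ℝ)

/-- [folklore] `TOf (Js 0) = TbalOf n Js 0` (`KInvStep n 0 = KInv n`, `vertexOfK_KInv`). -/
theorem TOf_eq_TbalOf_zero (Js : ℕ → JetData 3 n) : TOf (N := n) (Js 0) = TbalOf n Js 0 := by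
  show _ = TstepOf n 0 (Js 0)
  unfold TstepOf TOf
  have hV : vertexOfK (KInv (N := n) (d := 3)) n (Js 0).S = vertexOf (N := n) (Js 0).S :=
    funext fun μ => funext fun y => vertexOfK_KInv _ μ y
  rw [KInvStep_zero_eq, hV]

/-- [folklore] **THE LITERAL AT ITS OWN KERNEL (α-form)**: `TOf (JsB12CombShSym … 0) = hessKer G′ (vertexOfK G′ n S⁰) W⁰`, `G′ := GcombSh n 0`,
`(S⁰, W⁰) := ((JsB12CombSh0 … 0).S, (JsB12CombSh0 … 0).W)` (`TbalOf_JsB12CombShSym` at `j = 0`). -/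
theorem TOf_JsB12CombShSym_eq_hessKer_GcombSh :
    TOf (N := n) (JsB12CombShSym hodd N tabs cΛ cB 0)
      = hessKer (GcombSh n 0) (vertexOfK (GcombSh n 0) n (JsB12CombSh0 hodd N tabs cΛ cB 0).S) (JsB12CombSh0 hodd N tabs cΛ cB 0).W := by
  rw [TOf_eq_TbalOf_zero n (JsB12CombShSym hodd N tabs cΛ cB)]
  exact TbalOf_JsB12CombShSym hodd N tabs cΛ cB 0

/-- [folklore] The road's kernel `G₀^{bm}(ctrOff) := coDressKBmAt (toSite (ctrOff 4 n)) n (KInvStep n 0)` is spread. -/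
theorem spr_G₀bm : Spr (coDressKBmAt (toSite (ctrOff 4 n)) n (KInvStep (d := 3) n 0)) := by
  obtain ⟨δ, C, hδ, -, h⟩ := decays_coDressKBmAt_KInvStep (d := 3) (Lc := n) (ctrOff_mem_box (d := 4) (one_le_of_neZero n)) 0
  exact ⟨C, δ, hδ, h⟩

/-- [folklore] **THE LITERAL TRANSPORTED TO THE ROAD's KERNEL**: with `G₀ := coDressKBmAt (toSite (ctrOff 4 n)) n (KInvStep n 0)`, `Ψ̂ := psiKS (ctrOff 4 n) n`,
`TOf (JsB12CombShSym … 0) μ ν z = hessKer G₀ (μ y ↦ Ψ̂ᵀ∘vertexOfK G₀ n (slotPsiS (ctrOff 4 n) n S⁰) μ y∘Ψ̂) (μ y ν y′ ↦ Ψ̂ᵀ∘W⁰ μ y ν y′∘Ψ̂) μ ν z`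
(α-form + leaf-03's CHART TRANSPORT `GcombSh_zero_eq_conj_psiKS_KInvStep` + (T1)). -/
theorem TOf_JsB12CombShSym_eq_hessKer_bm_transported (μ ν : Fin 4) (z : Fin 4 → ℤ) :
    TOf (N := n) (JsB12CombShSym hodd N tabs cΛ cB 0) μ ν z
      = hessKer (coDressKBmAt (toSite (ctrOff 4 n)) n (KInvStep (d := 3) n 0))
          (fun μ' y => comp (comp (trK (psiKS (ctrOff 4 n) n))
            (vertexOfK (coDressKBmAt (toSite (ctrOff 4 n)) n (KInvStep (d := 3) n 0)) n
              (slotPsiS (ctrOff 4 n) n (JsB12CombSh0 hodd N tabs cΛ cB 0).S) μ' y)) (psiKS (ctrOff 4 n) n))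
          (fun μ' y ν' y' => comp (comp (trK (psiKS (ctrOff 4 n) n)) ((JsB12CombSh0 hodd N tabs cΛ cB 0).W μ' y ν' y')) (psiKS (ctrOff 4 n) n))
          μ ν z := by
  have hn : 0 < n := Nat.pos_of_ne_zero (NeZero.ne n)
  rw [TOf_JsB12CombShSym_eq_hessKer_GcombSh, GcombSh_zero_eq_conj_psiKS_KInvStep (d := 3) n]
  exact hessKer_conj_psiKS_vertexOfK hn (ctrOff_mem_box hn) (spr_G₀bm n) (JsB12CombSh0 hodd N tabs cΛ cB 0).loc
    (JsB12CombSh0 hodd N tabs cΛ cB 0).δ_pos _ (loc_jetData_W (JsB12CombSh0 hodd N tabs cΛ cB 0)) μ ν z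

/-- [folklore] **(T4) THE CHART DEFECT OF THE LITERAL IS THREE WORDS AT `G₀^{bm}(ctrOff)`** — for EVERY localised reference second-order family `W`:
`TOf (JsB12CombShSym … 0) μ ν z − hessKer G₀ (vertexOfK G₀ n S⁰) W μ ν z = ½·tadpole G₀ (Wᵈ μ 0 ν z) − ½·(bubble G₀ (V μ 0) (Vᵈ ν z) + bubble G₀ (Vᵈ μ 0) (V ν z))
− ½·bubble G₀ (Vᵈ μ 0) (Vᵈ ν z)`, `V := vertexOfK G₀ n S⁰`, `Vᵈ := Ψ̂ᵀ∘vertexOfK G₀ n (slotPsiS ρ n S⁰)∘Ψ̂ − V`, `Wᵈ := Ψ̂ᵀ∘W⁰∘Ψ̂ − W`. -/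
theorem chartDefect_literal_eq_words (W : Fin 4 → (Fin 4 → ℤ) → Fin 4 → (Fin 4 → ℤ) → MKer 4 (Fib 3)) (hW : ∀ μ y ν y', Loc (W μ y ν y'))
    (μ ν : Fin 4) (z : Fin 4 → ℤ) :
    TOf (N := n) (JsB12CombShSym hodd N tabs cΛ cB 0) μ ν z
        - hessKer (coDressKBmAt (toSite (ctrOff 4 n)) n (KInvStep (d := 3) n 0))
            (vertexOfK (coDressKBmAt (toSite (ctrOff 4 n)) n (KInvStep (d := 3) n 0)) n (JsB12CombSh0 hodd N tabs cΛ cB 0).S) W μ ν z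
      = (1 / 2) * tadpole (coDressKBmAt (toSite (ctrOff 4 n)) n (KInvStep (d := 3) n 0))
            (comp (comp (trK (psiKS (ctrOff 4 n) n)) ((JsB12CombSh0 hodd N tabs cΛ cB 0).W μ 0 ν z)) (psiKS (ctrOff 4 n) n) - W μ 0 ν z)
        - (1 / 2) * (bubble (coDressKBmAt (toSite (ctrOff 4 n)) n (KInvStep (d := 3) n 0))
              (vertexOfK (coDressKBmAt (toSite (ctrOff 4 n)) n (KInvStep (d := 3) n 0)) n (JsB12CombSh0 hodd N tabs cΛ cB 0).S μ 0)
              (comp (comp (trK (psiKS (ctrOff 4 n) n))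
                  (vertexOfK (coDressKBmAt (toSite (ctrOff 4 n)) n (KInvStep (d := 3) n 0)) n
                    (slotPsiS (ctrOff 4 n) n (JsB12CombSh0 hodd N tabs cΛ cB 0).S) ν z)) (psiKS (ctrOff 4 n) n)
                - vertexOfK (coDressKBmAt (toSite (ctrOff 4 n)) n (KInvStep (d := 3) n 0)) n (JsB12CombSh0 hodd N tabs cΛ cB 0).S ν z)
            + bubble (coDressKBmAt (toSite (ctrOff 4 n)) n (KInvStep (d := 3) n 0))
              (comp (comp (trK (psiKS (ctrOff 4 n) n))
                  (vertexOfK (coDressKBmAt (toSite (ctrOff 4 n)) n (KInvStep (d := 3) n 0)) n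
                    (slotPsiS (ctrOff 4 n) n (JsB12CombSh0 hodd N tabs cΛ cB 0).S) μ 0)) (psiKS (ctrOff 4 n) n)
                - vertexOfK (coDressKBmAt (toSite (ctrOff 4 n)) n (KInvStep (d := 3) n 0)) n (JsB12CombSh0 hodd N tabs cΛ cB 0).S μ 0)
              (vertexOfK (coDressKBmAt (toSite (ctrOff 4 n)) n (KInvStep (d := 3) n 0)) n (JsB12CombSh0 hodd N tabs cΛ cB 0).S ν z))
        - (1 / 2) * bubble (coDressKBmAt (toSite (ctrOff 4 n)) n (KInvStep (d := 3) n 0))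
            (comp (comp (trK (psiKS (ctrOff 4 n) n))
                (vertexOfK (coDressKBmAt (toSite (ctrOff 4 n)) n (KInvStep (d := 3) n 0)) n
                  (slotPsiS (ctrOff 4 n) n (JsB12CombSh0 hodd N tabs cΛ cB 0).S) μ 0)) (psiKS (ctrOff 4 n) n)
              - vertexOfK (coDressKBmAt (toSite (ctrOff 4 n)) n (KInvStep (d := 3) n 0)) n (JsB12CombSh0 hodd N tabs cΛ cB 0).S μ 0)
            (comp (comp (trK (psiKS (ctrOff 4 n) n))
                (vertexOfK (coDressKBmAt (toSite (ctrOff 4 n)) n (KInvStep (d := 3) n 0)) n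
                  (slotPsiS (ctrOff 4 n) n (JsB12CombSh0 hodd N tabs cΛ cB 0).S) ν z)) (psiKS (ctrOff 4 n) n)
              - vertexOfK (coDressKBmAt (toSite (ctrOff 4 n)) n (KInvStep (d := 3) n 0)) n (JsB12CombSh0 hodd N tabs cΛ cB 0).S ν z) := by
  have hn : 0 < n := Nat.pos_of_ne_zero (NeZero.ne n)
  rw [TOf_JsB12CombShSym_eq_hessKer_GcombSh, GcombSh_zero_eq_conj_psiKS_KInvStep (d := 3) n]
  exact chartDefect_eq_words hn (ctrOff_mem_box hn) (spr_G₀bm n) (JsB12CombSh0 hodd N tabs cΛ cB 0).loc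
    (JsB12CombSh0 hodd N tabs cΛ cB 0).δ_pos _ W (loc_jetData_W (JsB12CombSh0 hodd N tabs cΛ cB 0)) hW μ ν z

/-- [folklore] **(T4) AT THE ROAD's PAIR SLOT**: the same with the reference `W := vertex2OfK G₀ n S₂` of ANY fine bi-stencil family `S₂` (`LocStencil₂ S₂ C₂ δ₂`,
`0 ≤ C₂`, `0 < δ₂` — PART 22∕23-hyb's `hS₂ hCk hδ₂` shape at one scale). -/
theorem chartDefect_literal_eq_words_pair (S₂ : Fin 4 → (Fin 4 → ℤ) → Fin 4 → (Fin 4 → ℤ) → MKer 4 (Fib 3)) {C₂ δ₂ : ℝ}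
    (hS₂ : LocStencil₂ S₂ C₂ δ₂) (hC₂ : 0 ≤ C₂) (hδ₂ : 0 < δ₂) (μ ν : Fin 4) (z : Fin 4 → ℤ) :
    TOf (N := n) (JsB12CombShSym hodd N tabs cΛ cB 0) μ ν z
        - hessKer (coDressKBmAt (toSite (ctrOff 4 n)) n (KInvStep (d := 3) n 0))
            (vertexOfK (coDressKBmAt (toSite (ctrOff 4 n)) n (KInvStep (d := 3) n 0)) n (JsB12CombSh0 hodd N tabs cΛ cB 0).S)
            (vertex2OfK (coDressKBmAt (toSite (ctrOff 4 n)) n (KInvStep (d := 3) n 0)) n S₂) μ ν z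
      = (1 / 2) * tadpole (coDressKBmAt (toSite (ctrOff 4 n)) n (KInvStep (d := 3) n 0))
            (comp (comp (trK (psiKS (ctrOff 4 n) n)) ((JsB12CombSh0 hodd N tabs cΛ cB 0).W μ 0 ν z)) (psiKS (ctrOff 4 n) n)
              - vertex2OfK (coDressKBmAt (toSite (ctrOff 4 n)) n (KInvStep (d := 3) n 0)) n S₂ μ 0 ν z)
        - (1 / 2) * (bubble (coDressKBmAt (toSite (ctrOff 4 n)) n (KInvStep (d := 3) n 0))
              (vertexOfK (coDressKBmAt (toSite (ctrOff 4 n)) n (KInvStep (d := 3) n 0)) n (JsB12CombSh0 hodd N tabs cΛ cB 0).S μ 0)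
              (comp (comp (trK (psiKS (ctrOff 4 n) n))
                  (vertexOfK (coDressKBmAt (toSite (ctrOff 4 n)) n (KInvStep (d := 3) n 0)) n
                    (slotPsiS (ctrOff 4 n) n (JsB12CombSh0 hodd N tabs cΛ cB 0).S) ν z)) (psiKS (ctrOff 4 n) n)
                - vertexOfK (coDressKBmAt (toSite (ctrOff 4 n)) n (KInvStep (d := 3) n 0)) n (JsB12CombSh0 hodd N tabs cΛ cB 0).S ν z)
            + bubble (coDressKBmAt (toSite (ctrOff 4 n)) n (KInvStep (d := 3) n 0))
              (comp (comp (trK (psiKS (ctrOff 4 n) n))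
                  (vertexOfK (coDressKBmAt (toSite (ctrOff 4 n)) n (KInvStep (d := 3) n 0)) n
                    (slotPsiS (ctrOff 4 n) n (JsB12CombSh0 hodd N tabs cΛ cB 0).S) μ 0)) (psiKS (ctrOff 4 n) n)
                - vertexOfK (coDressKBmAt (toSite (ctrOff 4 n)) n (KInvStep (d := 3) n 0)) n (JsB12CombSh0 hodd N tabs cΛ cB 0).S μ 0)
              (vertexOfK (coDressKBmAt (toSite (ctrOff 4 n)) n (KInvStep (d := 3) n 0)) n (JsB12CombSh0 hodd N tabs cΛ cB 0).S ν z))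
        - (1 / 2) * bubble (coDressKBmAt (toSite (ctrOff 4 n)) n (KInvStep (d := 3) n 0))
            (comp (comp (trK (psiKS (ctrOff 4 n) n))
                (vertexOfK (coDressKBmAt (toSite (ctrOff 4 n)) n (KInvStep (d := 3) n 0)) n
                  (slotPsiS (ctrOff 4 n) n (JsB12CombSh0 hodd N tabs cΛ cB 0).S) μ 0)) (psiKS (ctrOff 4 n) n)
              - vertexOfK (coDressKBmAt (toSite (ctrOff 4 n)) n (KInvStep (d := 3) n 0)) n (JsB12CombSh0 hodd N tabs cΛ cB 0).S μ 0)
            (comp (comp (trK (psiKS (ctrOff 4 n) n))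
                (vertexOfK (coDressKBmAt (toSite (ctrOff 4 n)) n (KInvStep (d := 3) n 0)) n
                  (slotPsiS (ctrOff 4 n) n (JsB12CombSh0 hodd N tabs cΛ cB 0).S) ν z)) (psiKS (ctrOff 4 n) n)
              - vertexOfK (coDressKBmAt (toSite (ctrOff 4 n)) n (KInvStep (d := 3) n 0)) n (JsB12CombSh0 hodd N tabs cΛ cB 0).S ν z) :=
  chartDefect_literal_eq_words n hodd N tabs cΛ cB _ (loc_vertex2OfK_of_spr (spr_G₀bm n) hS₂ hC₂ hδ₂) μ ν z

end Literal

/-! ## §5 ON THE SCALES: PART 23-hyb's displayed defect `RJ1 (Lc^m)` at the literal of record `JcOfTabs`, word by word -/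

section Scales

variable {Lc : ℕ} [NeZero Lc] (hLc : Odd Lc) (N : ℕ) (tabs' : ∀ m : ℕ, SymTables 3 (Lc ^ m)) (cΛ cB : ℕ → ℝ) (m : ℕ)

/-- [folklore] **`RJ1` OF PART 23-hyb IS THREE WORDS** (R-D1-g43-3 (2) executed at the statement level): at EVERY scale `m`, for the literal of record
`Jc := JcOfTabs hLc N tabs′ cΛ cB` (any table record — `JcComp` included), the road kernel `G₀ := coDressKBmAt (toSite (ctrOff 4 (Lc^m))) (Lc^m) (KInvStep (Lc^m) 0)`,
the literal's RAW first-order family `S⁰ := (JsB12CombSh0 (Lc := Lc^m) … 0).S` (= PART 23-hyb's pinned `S (Lc^m)` at the locks of record) and ANY pair family `S₂`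
in PART 23-hyb's `hS₂` shape:
`TshotOf Lc Jc m μ ν z − hessKer G₀ (vertexOfK G₀ (Lc^m) S⁰) (vertex2OfK G₀ (Lc^m) S₂) μ ν z = ½·tadpole G₀ (Wᵈ μ 0 ν z) − ½·(bubble G₀ (V μ 0) (Vᵈ ν z)
+ bubble G₀ (Vᵈ μ 0) (V ν z)) − ½·bubble G₀ (Vᵈ μ 0) (Vᵈ ν z)` — the left side is `RJ1 (Lc^m) μ ν z` of `RoadEndBFxHybS.d1Rep_BFx_hyb_sbpS` (after `hrpin`, `hSpin`),
so its ONE ROW `hC₁` is the `m`-uniform (1.22) bound of these three one-loop words of the road's own functional. -/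
theorem RJ1_JcOfTabs_eq_words (S₂ : Fin 4 → (Fin 4 → ℤ) → Fin 4 → (Fin 4 → ℤ) → MKer 4 (Fib 3)) {C₂ δ₂ : ℝ}
    (hS₂ : ∀ κ u κ' u', BiLoc (S₂ κ u κ' u') u u (C₂ * Real.exp (-δ₂ * l1 (u' - u))) δ₂) (hC₂ : 0 ≤ C₂) (hδ₂ : 0 < δ₂)
    (μ ν : Fin 4) (z : Fin 4 → ℤ) :
    TshotOf Lc (JcOfTabs hLc N tabs' cΛ cB) m μ ν z
        - hessKer (coDressKBmAt (toSite (ctrOff 4 (Lc ^ m))) (Lc ^ m) (KInvStep (d := 3) (Lc ^ m) 0))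
            (vertexOfK (coDressKBmAt (toSite (ctrOff 4 (Lc ^ m))) (Lc ^ m) (KInvStep (d := 3) (Lc ^ m) 0)) (Lc ^ m)
              (JsB12CombSh0 (Lc := Lc ^ m) hLc.pow N (tabs' m) (cΛ m) (cB m) 0).S)
            (vertex2OfK (coDressKBmAt (toSite (ctrOff 4 (Lc ^ m))) (Lc ^ m) (KInvStep (d := 3) (Lc ^ m) 0)) (Lc ^ m) S₂) μ ν z
      = (1 / 2) * tadpole (coDressKBmAt (toSite (ctrOff 4 (Lc ^ m))) (Lc ^ m) (KInvStep (d := 3) (Lc ^ m) 0))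
            (comp (comp (trK (psiKS (ctrOff 4 (Lc ^ m)) (Lc ^ m)))
                ((JsB12CombSh0 (Lc := Lc ^ m) hLc.pow N (tabs' m) (cΛ m) (cB m) 0).W μ 0 ν z)) (psiKS (ctrOff 4 (Lc ^ m)) (Lc ^ m))
              - vertex2OfK (coDressKBmAt (toSite (ctrOff 4 (Lc ^ m))) (Lc ^ m) (KInvStep (d := 3) (Lc ^ m) 0)) (Lc ^ m) S₂ μ 0 ν z)
        - (1 / 2) * (bubble (coDressKBmAt (toSite (ctrOff 4 (Lc ^ m))) (Lc ^ m) (KInvStep (d := 3) (Lc ^ m) 0))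
              (vertexOfK (coDressKBmAt (toSite (ctrOff 4 (Lc ^ m))) (Lc ^ m) (KInvStep (d := 3) (Lc ^ m) 0)) (Lc ^ m)
                (JsB12CombSh0 (Lc := Lc ^ m) hLc.pow N (tabs' m) (cΛ m) (cB m) 0).S μ 0)
              (comp (comp (trK (psiKS (ctrOff 4 (Lc ^ m)) (Lc ^ m)))
                  (vertexOfK (coDressKBmAt (toSite (ctrOff 4 (Lc ^ m))) (Lc ^ m) (KInvStep (d := 3) (Lc ^ m) 0)) (Lc ^ m)
                    (slotPsiS (ctrOff 4 (Lc ^ m)) (Lc ^ m) (JsB12CombSh0 (Lc := Lc ^ m) hLc.pow N (tabs' m) (cΛ m) (cB m) 0).S) ν z))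
                  (psiKS (ctrOff 4 (Lc ^ m)) (Lc ^ m))
                - vertexOfK (coDressKBmAt (toSite (ctrOff 4 (Lc ^ m))) (Lc ^ m) (KInvStep (d := 3) (Lc ^ m) 0)) (Lc ^ m)
                    (JsB12CombSh0 (Lc := Lc ^ m) hLc.pow N (tabs' m) (cΛ m) (cB m) 0).S ν z)
            + bubble (coDressKBmAt (toSite (ctrOff 4 (Lc ^ m))) (Lc ^ m) (KInvStep (d := 3) (Lc ^ m) 0))
              (comp (comp (trK (psiKS (ctrOff 4 (Lc ^ m)) (Lc ^ m)))
                  (vertexOfK (coDressKBmAt (toSite (ctrOff 4 (Lc ^ m))) (Lc ^ m) (KInvStep (d := 3) (Lc ^ m) 0)) (Lc ^ m)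
                    (slotPsiS (ctrOff 4 (Lc ^ m)) (Lc ^ m) (JsB12CombSh0 (Lc := Lc ^ m) hLc.pow N (tabs' m) (cΛ m) (cB m) 0).S) μ 0))
                  (psiKS (ctrOff 4 (Lc ^ m)) (Lc ^ m))
                - vertexOfK (coDressKBmAt (toSite (ctrOff 4 (Lc ^ m))) (Lc ^ m) (KInvStep (d := 3) (Lc ^ m) 0)) (Lc ^ m)
                    (JsB12CombSh0 (Lc := Lc ^ m) hLc.pow N (tabs' m) (cΛ m) (cB m) 0).S μ 0)
              (vertexOfK (coDressKBmAt (toSite (ctrOff 4 (Lc ^ m))) (Lc ^ m) (KInvStep (d := 3) (Lc ^ m) 0)) (Lc ^ m)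
                (JsB12CombSh0 (Lc := Lc ^ m) hLc.pow N (tabs' m) (cΛ m) (cB m) 0).S ν z))
        - (1 / 2) * bubble (coDressKBmAt (toSite (ctrOff 4 (Lc ^ m))) (Lc ^ m) (KInvStep (d := 3) (Lc ^ m) 0))
            (comp (comp (trK (psiKS (ctrOff 4 (Lc ^ m)) (Lc ^ m)))
                (vertexOfK (coDressKBmAt (toSite (ctrOff 4 (Lc ^ m))) (Lc ^ m) (KInvStep (d := 3) (Lc ^ m) 0)) (Lc ^ m)
                  (slotPsiS (ctrOff 4 (Lc ^ m)) (Lc ^ m) (JsB12CombSh0 (Lc := Lc ^ m) hLc.pow N (tabs' m) (cΛ m) (cB m) 0).S) μ 0))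
                (psiKS (ctrOff 4 (Lc ^ m)) (Lc ^ m))
              - vertexOfK (coDressKBmAt (toSite (ctrOff 4 (Lc ^ m))) (Lc ^ m) (KInvStep (d := 3) (Lc ^ m) 0)) (Lc ^ m)
                  (JsB12CombSh0 (Lc := Lc ^ m) hLc.pow N (tabs' m) (cΛ m) (cB m) 0).S μ 0)
            (comp (comp (trK (psiKS (ctrOff 4 (Lc ^ m)) (Lc ^ m)))
                (vertexOfK (coDressKBmAt (toSite (ctrOff 4 (Lc ^ m))) (Lc ^ m) (KInvStep (d := 3) (Lc ^ m) 0)) (Lc ^ m)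
                  (slotPsiS (ctrOff 4 (Lc ^ m)) (Lc ^ m) (JsB12CombSh0 (Lc := Lc ^ m) hLc.pow N (tabs' m) (cΛ m) (cB m) 0).S) ν z))
                (psiKS (ctrOff 4 (Lc ^ m)) (Lc ^ m))
              - vertexOfK (coDressKBmAt (toSite (ctrOff 4 (Lc ^ m))) (Lc ^ m) (KInvStep (d := 3) (Lc ^ m) 0)) (Lc ^ m)
                  (JsB12CombSh0 (Lc := Lc ^ m) hLc.pow N (tabs' m) (cΛ m) (cB m) 0).S ν z) := by
  show TOf (N := Lc ^ m) (JcOfTabs hLc N tabs' cΛ cB m) μ ν z - _ = _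
  rw [JcOfTabs_apply]
  exact chartDefect_literal_eq_words_pair (Lc ^ m) hLc.pow N (tabs' m) (cΛ m) (cB m) S₂ hS₂ hC₂ hδ₂ μ ν z

end Scales

end Summit.QuantumFields.BalabanUV.Beta.D1BFx.ChartDefectWordsLiteral

end
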